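import Literature.Barriers.CriticalPhenomena.PlaquetteWalkHoleRootWestColumn
import Literature.Barriers.CriticalPhenomena.PlaquetteWalkHoleRootWestColumnSeven
import Literature.Barriers.CriticalPhenomena.PlaquetteWalkHoleRootWestRowSeven
import Literature.Barriers.CriticalPhenomena.PlaquetteWalkHoleRootWoundCostNS
import Literature.Barriers.CriticalPhenomena.PlaquetteWalkHoleRootCensusClasses
import Literature.Barriers.CriticalPhenomena.PlaquetteWalkHoleRootColumnLawAbove
import HarnessLib

/-!
# Barrier catalogue (SAWScalingLimit): the level-`5` class-`B2a` members of a `W`-rooted hole, POSITION-FREE — no kiss, straight prefix, the two census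
classes, one chirality, row coherence, the forced frame («LEVEL-5 B2a CLASSIFICATION, POSITION-FREE»)

`Z → ∞` limit model of the printed Yang–Baxter weights [GlazmanManolescu2019, §1, eq. (1)]; the «RECTANGLE COEFFICIENT» line of the venture lane «pcv-sawmu»
(b-engine-1 g28). `PlaquetteWalkHoleRootCensusClasses` proves the census classification of the wound class-`B2a` walks of limit cost `5` (FINDING-YB-LEVEL5-PHASE-LAW
§3: classes 'as'/'ao'/'ac', no `w₁`/`w₂` plaquette, `(ω.1; n_HL, n_VL, n_HR, n_VR) = (S; 3,2,0,0)` or `(N; 0,0,3,2)`, one chirality, `RowCoherent` with phase index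
`6`/`0`, the forced frame) under the POSITION hypotheses `r.2 = w.2` and `w.1 ≤ r.1`. Both are now theorems: `ΩG.rootRow_of_cost_five_colfree`
(`PlaquetteWalkHoleRootWestColumn`: the west column is excluded by an east-ray parity count, the row by `PlaquetteWalkHoleRootRowOnly`). This file restates the
classification for EVERY rooted rhombus `r` of EVERY domain with a `W`-normalised hole root:

* ★★★★ `ΩG.injective_of_wound_cost_five` — NO DOUBLY VISITED PLAQUETTE at limit cost `5`;
* ★★★ `ΩG.prefix_straight_of_wound_cost_five`, `ΩG.classes_of_wound_cost_five`, `ΩG.chirality_of_wound_cost_five`, `ΩG.rowCoherent_of_wound_cost_five`,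
  ★★★★ `ΩG.forced_frame_of_wound_cost_five` — the complete structure of a level-`5` class-`B2a` member, with no hypothesis beyond woundness and the cost;
* ★★★★ `ΩG.rootCol_le_of_cost_seven_vert` — with `PlaquetteWalkHoleRootWestColumnSeven` (off the hole row: the wall argument) and
  `PlaquetteWalkHoleRootWestRowSeven` (on the hole row: the chain of the last plaquette would cross the hole): EVERY cost-`7` vertical-end parent of a level-`5`
  class-`B2b` member lies in the root column or east of it; hence (`ΩG.rootCol_le_of_cost_ext₃_five`, `ΩG.no_level_five_member_west`) so does every level-`5`
  wound member, of either class, at any rooted rhombus of any domain (census kit j276221 / j298353: no cost-`5` wound member at any cell west of the root column);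
* ★★★★★ `woundCostGE_seven_west`, `woundLimitCoeff_five_eq_zero_west`, `ybVFPoly_coeff_eq_woundLimitCoeff_seven_west` — **THE LEVEL-`5` COEFFICIENT VANISHES
  WEST OF THE ROOT COLUMN**: at a rooted rhombus `f₀` with `f₀.1 < w.1` every wound group member costs at least `7`, `Λ₅(f₀) = 0`, the cleared printed vertex
  functional `P(Z) = (Z²·Den)^K·VF` has degree `≤ 4K − 6`, and its coefficient of `Z^{4K−6}` is the level-`7` wound limit sum `Λ₇` — the first candidate for
  «`VF ≢ 0`» west of the root column (FINDING-YB-LEVEL5-PHASE-LAW; DESIGN-next b-engine-1 g27 (N1));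
* ★★★★★ `vertexFunctional_printed_zero_set_finite_above'` / `…exists_ne_zero_above'` — the COLUMN LAW ABOVE (`PlaquetteWalkHoleRootColumnLawAbove`) with its
  position hypothesis `w.1 ≤ f₀.1` discharged.

[GlazmanManolescu2019 §1 Fig. 1, eq. (1), Lemma 2.1, Remark 2.2; Glazman2015WeightedSAW Lemma 3.1 (proof, pp. 6–7); CourantRobbins1958 Ch. V App. §2]
-/

noncomputable section

namespace Literature.Probability.RandomPlanarGeometry.SAW.YangBaxter

open Real
open Literature.Barriers.CriticalPhenomena.PlaquetteWalk

namespace ΩG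

variable {D : Set Face} {w r : Face} {ω : ΩG D (w.side .W) r}

/-- ★★★★ **NO KISS AT LEVEL `5`, POSITION-FREE**: a wound class-`B2a` walk of limit cost `5` from the hole root `w.side W` (hole `(w.1 − 1, w.2)` absent) visits
every plaquette at most once — at any rooted rhombus of any domain. [cite: GlazmanManolescu2019, §1, Fig. 1 and eq. (1); Lemma 2.1; Remark 2.2]
[cite: Glazman2015WeightedSAW, Lemma 3.1 (proof, pp. 6–7)] [cite: CourantRobbins1958, Ch. V Appendix §2 (the even–odd rule)] -/
theorem injective_of_wound_cost_five (hh : holeFaceW w ∉ D) (hr : RootedFace D (w.side .W) r) (h : ω.IsB2a)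
    (hA : ω.AJ hr h (toC (midPt (w.side .W))) ≠ 0) (hc : cost (slotOfSide ω.1) ω.2.mids = 5) :
    ∀ i j, i < ω.2.arcs.length → j < ω.2.arcs.length → ω.2.fc i = ω.2.fc j → i = j :=
  have hpos := rootRow_of_cost_five_colfree hh hr h hA hc
  injective_of_cost_five hh hr h hA hc hpos.1 hpos.2

/-- ★★★ **STRAIGHT PREFIX, POSITION-FREE**: a wound class-`B2a` walk of limit cost `5` from the hole root runs straight (due east along the root row) until
its first arc in `r`. [cite: GlazmanManolescu2019, §1, Fig. 1 and eq. (1); Lemma 2.1] [cite: Glazman2015WeightedSAW, Lemma 3.1 (proof, pp. 6–7)] -/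
theorem prefix_straight_of_wound_cost_five (hh : holeFaceW w ∉ D) (hr : RootedFace D (w.side .W) r) (h : ω.IsB2a)
    (hA : ω.AJ hr h (toC (midPt (w.side .W))) ≠ 0) (hc : cost (slotOfSide ω.1) ω.2.mids = 5) :
    ∀ i < ω.2.firstHitG, arcKind (ω.2.sIn i) (ω.2.sOut i) = .straight :=
  have hpos := rootRow_of_cost_five_colfree hh hr h hA hc
  prefix_straight_of_cost_five_rootRow hh hr h hA hc hpos.1 hpos.2

/-- ★★★ **THE TWO CENSUS CLASSES AT LEVEL `5`, POSITION-FREE**: no `w₁`/`w₂` plaquette, and `(ω.1; n_HL, n_VL, n_HR, n_VR) = (S; 3,2,0,0)` or `(N; 0,0,3,2)`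
(FINDING-YB-LEVEL5-PHASE-LAW §3, classes 'as'/'ao'/'ac'). [cite: GlazmanManolescu2019, §1, Fig. 1 and eq. (1); Lemma 2.1; Remark 2.2]
[cite: Glazman2015WeightedSAW, Lemma 3.1 (proof, pp. 6–7)] -/
theorem classes_of_wound_cost_five (hh : holeFaceW w ∉ D) (hr : RootedFace D (w.side .W) r) (h : ω.IsB2a)
    (hA : ω.AJ hr h (toC (midPt (w.side .W))) ≠ 0) (hc : cost (slotOfSide ω.1) ω.2.mids = 5) :
    cfgCount ω.2.mids [.corner, .corner] = 0 ∧ cfgCount ω.2.mids [.coCorner, .coCorner] = 0 ∧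
      ((ω.1 = .S ∧ hlCount ω.2.mids = 3 ∧ vlCount ω.2.mids = 2 ∧ hrCount ω.2.mids = 0 ∧ vrCount ω.2.mids = 0) ∨
        (ω.1 = .N ∧ hlCount ω.2.mids = 0 ∧ vlCount ω.2.mids = 0 ∧ hrCount ω.2.mids = 3 ∧ vrCount ω.2.mids = 2)) :=
  have hpos := rootRow_of_cost_five_colfree hh hr h hA hc
  classes_of_cost_five_rootRow hh hr h hA hc hpos.1 hpos.2

/-- ★★★ **ONE CHIRALITY, POSITION-FREE**: every turning arc of a wound class-`B2a` walk of limit cost `5` turns left (end on `S`), or every turning arc turns right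
(end on `N`). [cite: GlazmanManolescu2019, §1, Fig. 1 and eq. (1); Lemma 2.1] [cite: Glazman2015WeightedSAW, Lemma 3.1 (proof, pp. 6–7)] -/
theorem chirality_of_wound_cost_five (hh : holeFaceW w ∉ D) (hr : RootedFace D (w.side .W) r) (h : ω.IsB2a)
    (hA : ω.AJ hr h (toC (midPt (w.side .W))) ≠ 0) (hc : cost (slotOfSide ω.1) ω.2.mids = 5) :
    (ω.1 = .S ∧ ∀ p ∈ ω.2.arcs, qTurnOf p ≠ 0 → qTurnOf p = 1) ∨ (ω.1 = .N ∧ ∀ p ∈ ω.2.arcs, qTurnOf p ≠ 0 → qTurnOf p = -1) :=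
  have hpos := rootRow_of_cost_five_colfree hh hr h hA hc
  chirality_of_cost_five_rootRow hh hr h hA hc hpos.1 hpos.2

/-- ★★★ **ROW-COHERENT WITH PHASE INDEX `6` / `0`, POSITION-FREE**: the limit weight of every wound class-`B2a` walk of limit cost `5` from the hole root is
row coherent (`PlaquetteWalkAngleLimitRowCoherence`), with phase index `6` (end on `S`) or `0` (end on `N`). [cite: GlazmanManolescu2019, §1, Fig. 1 and eq. (1); Lemma 2.1, eq. (CR)]
[cite: Glazman2015WeightedSAW, Lemma 3.1 (proof, pp. 6–7)] -/
theorem rowCoherent_of_wound_cost_five (hh : holeFaceW w ∉ D) (hr : RootedFace D (w.side .W) r) (h : ω.IsB2a)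
    (hA : ω.AJ hr h (toC (midPt (w.side .W))) ≠ 0) (hc : cost (slotOfSide ω.1) ω.2.mids = 5) :
    RowCoherent (slotOfSide ω.1) ω.2.mids ∧ ((ω.1 = .S ∧ phaseIndex ω.2.mids = 6) ∨ (ω.1 = .N ∧ phaseIndex ω.2.mids = 0)) :=
  have hpos := rootRow_of_cost_five_colfree hh hr h hA hc
  rowCoherent_of_cost_five_rootRow hh hr h hA hc hpos.1 hpos.2

/-- ★★★★ **THE FORCED FRAME, POSITION-FREE**: a wound class-`B2a` walk of limit cost `5` from the hole root `w.side W` (hole absent), at ANY rooted rhombus, has a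
first turning arc `k₁` at the east end `(X', w.2)` (`X' ≥ w.1`, the rightmost column) of its straight initial run, and is the forced frame of
`forced_frame_of_isolated_first_turn` up to its fifth isolated turn `t` (leaving an extreme row vertically), after which it never turns again.
[cite: GlazmanManolescu2019, §1, Fig. 1 and eq. (1); Lemma 2.1; Remark 2.2] [cite: Glazman2015WeightedSAW, Lemma 3.1 (proof, pp. 6–7)]
[cite: CourantRobbins1958, Ch. V Appendix §2 (the even–odd rule)] -/
theorem forced_frame_of_wound_cost_five (hh : holeFaceW w ∉ D) (hr : RootedFace D (w.side .W) r) (h : ω.IsB2a)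
    (hA : ω.AJ hr h (toC (midPt (w.side .W))) ≠ 0) (hc : cost (slotOfSide ω.1) ω.2.mids = 5) :
    ∃ k₁ t : ℕ, k₁ < t ∧ t < ω.2.arcs.length ∧ (∀ i < k₁, arcKind (ω.2.sIn i) (ω.2.sOut i) = .straight) ∧
      (∃ X' Y Y' : ℤ, w.1 ≤ X' ∧ Y' < w.2 ∧ w.2 < Y ∧ (∀ j < ω.2.arcs.length, (ω.2.fc j).1 ≤ X' ∧ Y' ≤ (ω.2.fc j).2 ∧ (ω.2.fc j).2 ≤ Y) ∧
        ω.2.fc k₁ = (X', w.2) ∧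
        (((ω.2.fc t).2 = Y' ∧ ω.2.sOut t = .N) ∨ ((ω.2.fc t).2 = Y ∧ ω.2.sOut t = .S))) ∧
      arcKind (ω.2.sIn t) (ω.2.sOut t) ≠ .straight ∧
      (∀ i, t < i → i < ω.2.arcs.length → arcKind (ω.2.sIn i) (ω.2.sOut i) = .straight) :=
  have hpos := rootRow_of_cost_five_colfree hh hr h hA hc
  forced_frame_of_cost_five_rootRow hh hr h hA hc hpos.1 hpos.2

/-! ## Level-`5` class-`B2b` members: their cost-`7` vertical-end parents live in the root column or east of it -/

/-- ★★★★ **NO COST-`7` VERTICAL-END PARENT WEST OF THE ROOT COLUMN.** A wound class-`B2a` walk of limit cost `7` from the hole root `w.side W` (hole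
`(w.1 − 1, w.2)` absent) ending on a vertical side of a rhombus `r`, with a turning first arc in `r`, has `w.1 ≤ r.1`: off the hole row by
`rootCol_le_of_cost_seven_vert_off_row` (the wall argument), on the hole row by `not_cost_seven_vert_rootRow_west` (the chain through the hole).
[cite: GlazmanManolescu2019, §1, Fig. 1 and eq. (1); Lemma 2.1 (proof: the groups); Remark 2.2] [cite: Glazman2015WeightedSAW, Lemma 3.1 (proof, pp. 6–7)]
[cite: CourantRobbins1958, Ch. V Appendix §2 (the even–odd rule)] -/
theorem rootCol_le_of_cost_seven_vert (hh : holeFaceW w ∉ D) (hr : RootedFace D (w.side .W) r) (h : ω.IsB2a)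
    (hA : ω.AJ hr h (toC (midPt (w.side .W))) ≠ 0) (hc : cost (slotOfSide ω.1) ω.2.mids = 7) (hz : ω.1 = .E ∨ ω.1 = .W)
    (hNS : arcKind (ω.2.sIn ω.2.firstHitG) (ω.2.sOut ω.2.firstHitG) ≠ .straight) : w.1 ≤ r.1 := by
  by_cases hrow : r.2 = w.2
  · by_contra hlt
    push Not at hlt
    exact not_cost_seven_vert_rootRow_west hh hr h hA hc hz hNS hrow hlt
  · exact rootCol_le_of_cost_seven_vert_off_row hh hr h hA hc hz hNS hrow

/-- ★★★★ **THE PARENT OF EVERY LEVEL-`5` CLASS-`B2b` MEMBER LIES IN THE ROOT COLUMN OR EAST OF IT.** Let `ω` be a wound class-`B2a` walk from the hole root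
`w.side W` (hole absent) with a turning first arc in `r` whose class-`B2b` extension `ext₃ ω` has limit cost `5`. Then `w.1 ≤ r.1`: by `cost_ext₃_eq_five_iff`
the parent has cost `5` and a slanted end (`rootCol_le_of_cost_five`) or cost `7` and a vertical end (`rootCol_le_of_cost_seven_vert`).
[cite: GlazmanManolescu2019, §1, Fig. 1 and eq. (1); Lemma 2.1 (proof: the groups); Remark 2.2] [cite: Glazman2015WeightedSAW, Lemma 3.1 (proof, pp. 6–7)]
[cite: CourantRobbins1958, Ch. V Appendix §2 (the even–odd rule)] -/
theorem rootCol_le_of_cost_ext₃_five (hh : holeFaceW w ∉ D) (hr : RootedFace D (w.side .W) r) (h : ω.IsB2a)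
    (hA : ω.AJ hr h (toC (midPt (w.side .W))) ≠ 0) (hNS : arcKind (ω.2.sIn ω.2.firstHitG) (ω.2.sOut ω.2.firstHitG) ≠ .straight)
    (hc : cost (slotOfSide (ω.ext₃ hr).1) (ω.ext₃ hr).2.mids = 5) : w.1 ≤ r.1 := by
  rcases (cost_ext₃_eq_five_iff hr h hNS).1 hc with ⟨hc5, -⟩ | ⟨hc7, hz⟩
  · exact rootCol_le_of_cost_five hh hr h hA hc5
  · exact rootCol_le_of_cost_seven_vert hh hr h hA hc7 hz hNS

/-- ★★★★ **NO LEVEL-`5` WOUND MEMBER WEST OF THE ROOT COLUMN**: at a rhombus `r` with `r.1 < w.1`, no wound class-`B2a` walk from the hole root has limit cost `5`,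
and no wound class-`B2a` walk with a turning first arc has a class-`B2b` extension of limit cost `5` — the two kinds of level-`5` member of a wound group.
[cite: GlazmanManolescu2019, §1, Fig. 1 and eq. (1); Lemma 2.1 (proof: the groups); Remark 2.2] [cite: Glazman2015WeightedSAW, Lemma 3.1 (proof, pp. 6–7)]
[cite: CourantRobbins1958, Ch. V Appendix §2 (the even–odd rule)] -/
theorem no_level_five_member_west (hh : holeFaceW w ∉ D) (hr : RootedFace D (w.side .W) r) (h : ω.IsB2a)
    (hA : ω.AJ hr h (toC (midPt (w.side .W))) ≠ 0) (hwest : r.1 < w.1) :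
    cost (slotOfSide ω.1) ω.2.mids ≠ 5 ∧
      (arcKind (ω.2.sIn ω.2.firstHitG) (ω.2.sOut ω.2.firstHitG) ≠ .straight → cost (slotOfSide (ω.ext₃ hr).1) (ω.ext₃ hr).2.mids ≠ 5) := by
  refine ⟨fun hc => ?_, fun hNS hc => ?_⟩
  · have := rootCol_le_of_cost_five hh hr h hA hc; omega
  · have := rootCol_le_of_cost_ext₃_five hh hr h hA hNS hc; omega

/-- **COST PARITY AT A HOLE ROOT**: the limit cost of a walk of the model from the (vertical) hole root to a side of `r` is odd — `n_{u₁} + n_{u₂}` is even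
iff the end side is vertical (`cfgCount_corner_add_coCorner_mod_two`), and the slot degree adds one exactly for horizontal ends.
[cite: GlazmanManolescu2019, §1, Fig. 1 and eq. (1) (the corner / co-corner plaquettes); Lemma 2.1] -/
theorem cost_mod_two_eq_one (ω : ΩG D (w.side .W) r) : cost (slotOfSide ω.1) ω.2.mids % 2 = 1 := by
  have hpar := cfgCount_corner_add_coCorner_mod_two ω.2
  obtain ⟨hvW, -, -, -⟩ := vertB_side w
  obtain ⟨hrW, hrE, hrS, hrN⟩ := vertB_side r
  rw [hvW] at hpar
  have hcost : cost (slotOfSide ω.1) ω.2.mids =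
      cfgCount ω.2.mids [.corner] + cfgCount ω.2.mids [.coCorner] + (1 - slotDeg (slotOfSide ω.1)) := rfl
  have hds : ∀ s : Side, (slotDeg (slotOfSide s) = 0 ∧ vertB (r.side s) = true) ∨ (slotDeg (slotOfSide s) = 1 ∧ vertB (r.side s) = false) := by
    intro s
    cases s
    · exact Or.inl ⟨by decide, hrW⟩
    · exact Or.inl ⟨by decide, hrE⟩
    · exact Or.inr ⟨by decide, hrS⟩
    · exact Or.inr ⟨by decide, hrN⟩
  rcases hds ω.1 with ⟨hd, hv⟩ | ⟨hd, hv⟩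
  · rw [hv, if_pos rfl] at hpar; rw [hcost, hd]; omega
  · rw [hv, if_neg (by decide)] at hpar; rw [hcost, hd]; omega

end ΩG

end Literature.Probability.RandomPlanarGeometry.SAW.YangBaxter

namespace Literature.Barriers.CriticalPhenomena.PlaquetteWalk

open Literature.Probability.RandomPlanarGeometry.SAW.YangBaxter
open Real

open private fc_fh from Literature.Probability.RandomPlanarGeometry.YangBaxterSAWGeneralDomain

/-! ## The level-`5` coefficient vanishes west of the root column -/

open Classical in
/-- ★★★★★ **EVERY WOUND GROUP MEMBER WEST OF THE ROOT COLUMN COSTS AT LEAST `7`.** For the root `a = w.side W` of a finite domain `dom Dl` with the hole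
`(w.1 − 1, w.2)` absent and a rooted rhombus `f₀` with `f₀.1 < w.1`: `WoundCostGE Dl a f₀ hr 7` — the class-`B2a` member costs `≥ 5` (`five_le_cost_of_wound`),
not `5` (`rootCol_le_of_cost_five`), not `6` (parity); the class-`B2b` extension of an `NS` group costs `cost ω` (slanted parent) or `cost ω − 2` (vertical parent,
`cost_ext₃_add_two`), and a vertical parent costs `≥ 7` (`seven_le_cost_of_wound_NS`), not `7` (`rootCol_le_of_cost_seven_vert`), not `8` (parity).
[cite: GlazmanManolescu2019, Lemma 2.1 (proof: the groups) and eq. (1); Remark 2.2] [cite: Glazman2015WeightedSAW, Lemma 3.1 (proof, pp. 6–7)]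
[cite: CourantRobbins1958, Ch. V Appendix §2 (the even–odd rule)] -/
theorem woundCostGE_seven_west (Dl : List Face) {w f₀ : Face} (hh : holeFaceW w ∉ dom Dl) (hr : RootedFace (dom Dl) (w.side .W) f₀)
    (hwest : f₀.1 < w.1) : WoundCostGE Dl (w.side .W) f₀ hr 7 := by
  classical
  intro ω hω
  rw [Finset.mem_filter] at hω
  obtain ⟨-, hU⟩ := hω
  rw [ΩG.unwound_iff_AJ_root_eq_zero] at hU
  push Not at hU
  obtain ⟨h, hA⟩ := hU
  obtain ⟨-, hsInF, hsOutF⟩ := fc_fh ω hr h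
  have hpar := ΩG.cost_mod_two_eq_one ω
  have h5 := ΩG.five_le_cost_of_wound hh hr h hA
  have hne5 : cost (slotOfSide ω.1) ω.2.mids ≠ 5 := fun hc => by
    have := ΩG.rootCol_le_of_cost_five hh hr h hA hc; omega
  have h7 : 7 ≤ cost (slotOfSide ω.1) ω.2.mids := by omega
  refine ⟨h7, fun hN => ?_⟩
  have hN' : ∃ hB : ω.IsB2a, arcKind ω.2.firstSideG (ω.2.exitSideG hr (ω.fh_lt hB)) ≠ .straight := hN
  obtain ⟨hB, hk⟩ := hN'
  have hNS : arcKind (ω.2.sIn ω.2.firstHitG) (ω.2.sOut ω.2.firstHitG) ≠ .straight := by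
    rw [hsInF, hsOutF]; exact hk
  have h2 := ΩG.cost_ext₃_add_two hr h hNS
  have key : ∀ u : Side, (slotDeg (slotOfSide u) = 1 ∧ (u = .N ∨ u = .S)) ∨ (slotDeg (slotOfSide u) = 0 ∧ (u = .E ∨ u = .W)) := by
    intro u; cases u <;> decide
  rcases key ω.1 with ⟨hd, -⟩ | ⟨hd, hz⟩
  · rw [hd] at h2; omega
  · rw [hd] at h2
    have hz' : ω.1 = .W ∨ ω.1 = .E := hz.symm
    have h7' := ΩG.seven_le_cost_of_wound_NS hh hr h hA hNS hz'
    have hne7 : cost (slotOfSide ω.1) ω.2.mids ≠ 7 := fun hc => by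
      have := ΩG.rootCol_le_of_cost_seven_vert hh hr h hA hc hz hNS; omega
    omega

open Classical in
/-- ★★★★★ **THE LEVEL-`5` COEFFICIENT VANISHES WEST OF THE ROOT COLUMN**: at a rooted rhombus `f₀` with `f₀.1 < w.1` the level-`5` wound limit sum `Λ₅` of the
printed Yang–Baxter vertex functional is zero (no wound group member there has limit cost `5`). [cite: GlazmanManolescu2019, Lemma 2.1 (proof: the groups) and eq. (1); Remark 2.2]
[cite: Glazman2015WeightedSAW, Lemma 3.1 (proof, pp. 6–7)] [cite: CourantRobbins1958, Ch. V Appendix §2 (the even–odd rule)] -/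
theorem woundLimitCoeff_five_eq_zero_west (Dl : List Face) {w f₀ : Face} (hh : holeFaceW w ∉ dom Dl) (hr : RootedFace (dom Dl) (w.side .W) f₀)
    (hwest : f₀.1 < w.1) (K : ℕ) : woundLimitCoeff Dl (w.side .W) f₀ hr K 5 = 0 := by
  classical
  unfold woundLimitCoeff
  refine Finset.sum_eq_zero fun ω hω => ?_
  obtain ⟨h7, h7'⟩ := woundCostGE_seven_west Dl hh hr hwest ω hω
  rw [if_neg (by omega), if_neg (fun hc => by have := h7' hc.1; omega), add_zero]

/-- ★★★★★ **WEST OF THE ROOT COLUMN THE CLEARED VERTEX FUNCTIONAL STARTS AT LEVEL `7`**: at a rooted rhombus `f₀` with `f₀.1 < w.1`, for every `K ≥ maxExp`,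
the polynomial `P(Z) = (Z²·Den)^K·VF_{Dl}(w.side W, f₀; ·)` has degree `≤ 4K − 6` and its coefficient of `Z^{4K−6}` is the level-`7` wound limit sum `Λ₇`.
[cite: GlazmanManolescu2019, Lemma 2.1 (proof: the groups) and eq. (1); Remark 2.2] [cite: Glazman2015WeightedSAW, Lemma 3.1 (proof, pp. 6–7)] -/
theorem ybVFPoly_coeff_eq_woundLimitCoeff_seven_west (Dl : List Face) {w f₀ : Face} (hh : holeFaceW w ∉ dom Dl)
    (hr : RootedFace (dom Dl) (w.side .W) f₀) (hwest : f₀.1 < w.1) {K : ℕ} (hK : maxExp Dl (w.side .W) f₀ ≤ K) :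
    (ybVFPoly Dl (w.side .W) f₀ K).coeff (4 * K + 1 - 7) = woundLimitCoeff Dl (w.side .W) f₀ hr K 7 ∧
      (ybVFPoly Dl (w.side .W) f₀ K).natDegree ≤ 4 * K + 1 - 7 :=
  ⟨ybVFPoly_coeff_eq_woundLimitCoeff Dl (w.side .W) f₀ hr hK (woundCostGE_seven_west Dl hh hr hwest),
    natDegree_ybVFPoly_le_of_woundCostGE Dl (w.side .W) f₀ hr hK (woundCostGE_seven_west Dl hh hr hwest)⟩

/-! ## The column law above the root row, position-free -/

open Classical in
/-- ★★★★★ **THE COLUMN LAW ABOVE THE ROOT ROW, POSITION-FREE.** Let `a = w.side W` be a `W`-normalised hole root of `dom Dl` (hole absent) and `f₀` a rooted rhombus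
strictly above the root row carrying a wound class-`B2a` walk with a turning first arc in `f₀` whose extension has limit cost `5`. Then `w.1 ≤ f₀.1`
(`ΩG.rootCol_le_of_cost_ext₃_five`) and the zero set in `θ ∈ (0, π)` of the printed vertex functional at `f₀` is finite with at most `4·maxExp − 4` elements
(`vertexFunctional_printed_zero_set_finite_above` with its position hypothesis discharged). [cite: GlazmanManolescu2019, Lemma 2.1 and eq. (1); Remark 2.2]
[cite: Glazman2015WeightedSAW, Lemma 3.1 (proof, pp. 6–7)] [cite: CourantRobbins1958, Ch. V Appendix §2 (the even–odd rule)] -/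
theorem vertexFunctional_printed_zero_set_finite_above' (Dl : List Face) {w f₀ : Face} (hh : holeFaceW w ∉ dom Dl)
    (hr : RootedFace (dom Dl) (w.side .W) f₀) (habove : w.2 < f₀.2)
    (hex : ∃ (ω : ΩG (dom Dl) (w.side .W) f₀) (h : ω.IsB2a), ω.AJ hr h (toC (midPt (w.side .W))) ≠ 0 ∧
      arcKind (ω.2.sIn ω.2.firstHitG) (ω.2.sOut ω.2.firstHitG) ≠ .straight ∧
        cost (slotOfSide (ω.ext₃ hr).1) (ω.ext₃ hr).2.mids = 5) :
    {θ ∈ Set.Ioo 0 π | vertexFunctional (printedWeights θ) tFiveEighths (ybCoeff θ) Dl (w.side .W) f₀ = 0}.Finite ∧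
      {θ ∈ Set.Ioo 0 π | vertexFunctional (printedWeights θ) tFiveEighths (ybCoeff θ) Dl (w.side .W) f₀ = 0}.ncard ≤
        4 * maxExp Dl (w.side .W) f₀ + 1 - 5 := by
  obtain ⟨ω, h, hA, hNS, hc⟩ := hex
  exact vertexFunctional_printed_zero_set_finite_above Dl hh hr habove (ΩG.rootCol_le_of_cost_ext₃_five hh hr h hA hNS hc) ⟨ω, h, hA, hNS, hc⟩

open Classical in
/-- ★★★★★ **THE COLUMN LAW ABOVE THE ROOT ROW, POSITION-FREE**: under the same hypotheses some `θ ∈ (0, π)` has a NON-VANISHING printed vertex functional at `f₀`.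
[cite: GlazmanManolescu2019, Lemma 2.1 and eq. (1); Remark 2.2] [cite: Glazman2015WeightedSAW, Lemma 3.1 (proof, pp. 6–7)] -/
theorem vertexFunctional_printed_exists_ne_zero_above' (Dl : List Face) {w f₀ : Face} (hh : holeFaceW w ∉ dom Dl)
    (hr : RootedFace (dom Dl) (w.side .W) f₀) (habove : w.2 < f₀.2)
    (hex : ∃ (ω : ΩG (dom Dl) (w.side .W) f₀) (h : ω.IsB2a), ω.AJ hr h (toC (midPt (w.side .W))) ≠ 0 ∧
      arcKind (ω.2.sIn ω.2.firstHitG) (ω.2.sOut ω.2.firstHitG) ≠ .straight ∧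
        cost (slotOfSide (ω.ext₃ hr).1) (ω.ext₃ hr).2.mids = 5) :
    ∃ θ ∈ Set.Ioo 0 π, vertexFunctional (printedWeights θ) tFiveEighths (ybCoeff θ) Dl (w.side .W) f₀ ≠ 0 := by
  obtain ⟨ω, h, hA, hNS, hc⟩ := hex
  exact vertexFunctional_printed_exists_ne_zero_above Dl hh hr habove (ΩG.rootCol_le_of_cost_ext₃_five hh hr h hA hNS hc) ⟨ω, h, hA, hNS, hc⟩

end Literature.Barriers.CriticalPhenomena.PlaquetteWalk
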